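import Mathlib
import HarnessLib
import Summits.NavierStokesRegularity.NavierStokesRegularity.Theses.LocalLambTubeDoor
import Summits.NavierStokesRegularity.NavierStokesRegularity.Theorems.LocalSineTubeDoorLocalPointZoomGradSlices

/-!
# Route `LocalLambTubeDoor` (S12, rung N0-LocalTubeDoorLamb) — crux K1 `LocalPointZoomVelGradSlices` is a THEOREM

Cell ns-regularity-ideate, seat p6 (birth filing; the route was opened from the staged package
HOME/ns-regularity-ideate-p6/route-lamb/).  The crux text is VERBATIM the statement of the tree theorem
`…Theorems.LocalSineTubeDoorLocalPointZoomGradSlices.localPointZoomVelGradSlices` (p441522, the universal first-order zoom of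
the door family: velocity AND gradient convergence on every slice along one sequence); this file records it BY NAME against
the born Theses decl (closing item stmt-NavierStokesRegularity-19815).

WHAT THIS IS NOT: not a claim about Navier–Stokes regularity (Clay A).  The leaf is a regularity CRITERION (local Type I
+ L¹-fading of the scale-normalised Lamb vector (T−t)^{3/2}·u × curl u on ONE similarity window ⇒ backward bounded), one
rung of LADDER-NS N0 (N0-LocalTubeDoorLamb); establishment in the cell's sense still requires the cross-family referee
PASS + independent reproduction.
-/

noncomputable section

-- the summit and its single sub-problem share the name (CONVENTIONS §1), as in every Theorems file
set_option linter.dupNamespace false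

namespace Summit.NavierStokesRegularity.NavierStokesRegularity.Theorems.LocalLambTubeDoorLocalPointZoomVelGradSlicesClose

open Summit.NavierStokesRegularity.NavierStokesRegularity.Theorems.LocalSineTubeDoorLocalPointZoomGradSlices

/-- **Crux K1 `LocalPointZoomVelGradSlices` (item stmt-NavierStokesRegularity-19815) is a THEOREM**: the born decl unfolds to the
statement of `localPointZoomVelGradSlices` (p441522). -/
theorem localPointZoomVelGradSlices_proof :
    Summit.NavierStokesRegularity.NavierStokesRegularity.Theses.LocalLambTubeDoor.LocalPointZoomVelGradSlices := by
  unfold Summit.NavierStokesRegularity.NavierStokesRegularity.Theses.LocalLambTubeDoor.LocalPointZoomVelGradSlices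
  exact localPointZoomVelGradSlices

end Summit.NavierStokesRegularity.NavierStokesRegularity.Theorems.LocalLambTubeDoorLocalPointZoomVelGradSlicesClose

end
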